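import Summits.BirchSwinnertonDyer.BirchSwinnertonDyer.Theorems.ShaPrimaryTransferFiniteShaComponentTransferZywinaEqualityDoorKeys
import Literature.Barriers.BirchSwinnertonDyer.PAdicFunctionalEquationParityAnyPrimeProofs
import Literature.NumberTheory.EllipticCurves.SelmerCorankHolds
import HarnessLib

/-!
# BirchSwinnertonDyer / ShaPrimaryTransfer — crux `FiniteShaComponentTransfer` (stmt-BirchSwinnertonDyer-22356):
# the door AND parity — the RESIDUAL ALTERNATIVE on Zywina's classes is `ord_{T=0} L_5 ≥ 4 ∧ corank Ш[5^∞] ≥ 2`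

Companion of `…ZywinaEqualityDoorKeys` (p763232).  Parity enters twice, both as theorems-mod-print: (a) the `p`-adic functional
equation at the conductor level gives `w(E) = (−1)^{ord_{T=0} L_p(E,T)}` (tree theorem
`rootNumber_eq_neg_one_pow_order_padicLFunction_conductorLevel_anyPrime`), and `w(E_{m,n}) = +1` by `2`-parity
(Dokchitser–Dokchitser) + `corank Sel_{2^∞}(E_{m,n}) = 2` (Zywina; tree `rootNumber_zywinaCurve`); (b) `p`-parity
`(−1)^{corank Sel_{p^∞}} = w` makes `t_p(E_{m,n}) = corank Sel_{p^∞} − 2` EVEN.  With the door (`…Keys`): on a member of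
`zywinaClass 5 K m₁ M` (`7 ∣ M`, R* hypotheses), granting PRS 85, BCS and parity,
EITHER `ord_{T=0} L_5(E_{m,n},T) = 2 ∧ Ш(E_{m,n})[5^∞]` finite (`t_5 = 0`) OR `ord_{T=0} L_5 ≥ 4 ∧ t_5 ≥ 2` — there is no
intermediate failure mode.  B1: windows/alternatives only; no `ord_T L_5` and no `r_an` is certified for any member.
References: D. Zywina, arXiv:2502.01957; T. Dokchitser–V. Dokchitser, Ann. of Math. 172 (2010) Thm. 1.4; R. Greenberg, LNM 1716
§5; B. Mazur–J. Tate–J. Teitelbaum, Invent. Math. 84 (1986) §I.17–18.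
-/

-- D-0017: single-problem summit, so `Summit.BirchSwinnertonDyer.BirchSwinnertonDyer.…` repeats a namespace BY DESIGN.
set_option linter.dupNamespace false

noncomputable section

namespace Summit.BirchSwinnertonDyer.BirchSwinnertonDyer.Theorems.ShaPrimaryTransferZywinaEqualityDoorParity

open scoped MatrixGroups ModularForm
open CongruenceSubgroup
open Literature.NumberTheory.EllipticCurves Literature.NumberTheory.EllipticCurves.Zywina2025
  Literature.NumberTheory.EllipticCurves.ModularForms
open Literature.NumberTheory.Sieve (TaoZiegler2008_polynomialProgressions)
open Literature.Barriers.BirchSwinnertonDyer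
open WeierstrassCurve
open Summit.BirchSwinnertonDyer.BirchSwinnertonDyer.Rank1Residual
open Summit.BirchSwinnertonDyer.Rank1Residual.Additive
open Summit.BirchSwinnertonDyer.BirchSwinnertonDyer.Theorems.ShaPrimaryTransferGoodOrdinaryFive
open Summit.BirchSwinnertonDyer.BirchSwinnertonDyer.Theorems.ShaPrimaryTransferZywinaEqualityDoor
open Summit.BirchSwinnertonDyer.BirchSwinnertonDyer.Theorems.ShaPrimaryTransferZywinaEqualityDoorClasses
open Summit.BirchSwinnertonDyer.BirchSwinnertonDyer.Theorems.ShaPrimaryTransferZywinaEqualityDoorKeys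

section Parity

variable {m n : ℕ}

/-- **`ord_{T=0} L_p(E_{m,n},T)` is EVEN** at every good ordinary `p` of `E_{m,n}` (newform `f` at the conductor level):
`w(E_{m,n}) = +1` (`2`-parity + Zywina's `2`-descent) and `w = (−1)^{ord_T L_p}` (the `p`-adic functional equation).
CONDITIONAL on `hpar` (`2`-parity, Dokchitser–Dokchitser). [cite: DokchitserDokchitser2010, Thm 1.4]
[cite: GreenbergLNM1716, §5 (p. 181, `λ_E^{anal} = 1` passage)] [cite: Zywina2025, Thm 1.2] -/
theorem even_toNat_order_padicLFunction_zywinaCurve (hpar : ∀ (V : WeierstrassCurve ℚ) [V.IsElliptic], p_parity V 2)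
    (h : ZywinaAdmissible m n) [(zywinaCurve m n).IsElliptic] [(zywinaCurve m n).IsGloballyMinimal]
    [NeZero ((zywinaCurve m n).conductorNorm ℤ)] (p : ℕ) [Fact p.Prime]
    (hord : IsOrdinaryAt (zywinaCurve m n) p) {f : CuspForm (Gamma0 ((zywinaCurve m n).conductorNorm ℤ)) 2}
    (hf : IsNewformOf (zywinaCurve m n) f) :
    Even (padicLFunction f (unitRoot (zywinaCurve m n) p : ℚ_[p])).order.toNat := by
  have hsign := rootNumber_eq_neg_one_pow_order_padicLFunction_conductorLevel_anyPrime hord hf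
  rw [rootNumber_zywinaCurve hpar h] at hsign
  have hneg : (-1 : ℚ_[p]) ≠ 1 := by norm_num
  rw [← neg_one_pow_eq_one_iff_even hneg, ← hsign]
  push_cast
  rfl

/-- **`t_p(E_{m,n})` is EVEN** for every prime `p`: `(−1)^{corank Sel_{p^∞}} = w(E_{m,n}) = +1` (`p`-parity and `2`-parity)
and `corank Sel_{p^∞} = rank + t_p = 2 + t_p`. CONDITIONAL on `hpar`, `hparp` (Dokchitser–Dokchitser `p`-parity).
[cite: DokchitserDokchitser2010, Thm 1.4] [cite: Zywina2025, Thm 1.2] -/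
theorem even_shaCorank_zywinaCurve (hpar : ∀ (V : WeierstrassCurve ℚ) [V.IsElliptic], p_parity V 2)
    (h : ZywinaAdmissible m n) [(zywinaCurve m n).IsElliptic] (p : ℕ) [Fact p.Prime]
    (hparp : p_parity (zywinaCurve m n) p) : Even ((zywinaCurve m n).shaCorank p) := by
  have key : (-1 : ℤ) ^ (zywinaCurve m n).selmerCorank p = 1 := by
    rw [hparp, rootNumber_zywinaCurve hpar h]
  have hneg : (-1 : ℤ) ≠ 1 := by norm_num
  have hsel : Even ((zywinaCurve m n).selmerCorank p) := (neg_one_pow_eq_one_iff_even hneg).mp key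
  rw [(zywinaCurve m n).selmerCorank_eq_mordellWeilRank_add_holds p, mordellWeilRank_zywinaCurve h] at hsel
  obtain ⟨k, hk⟩ := hsel
  exact ⟨k - 1, by omega⟩

/-- `t_p(E_{m,n}) = 0 ∨ 2 ≤ t_p(E_{m,n})`. CONDITIONAL on `hpar`, `hparp`. [cite: DokchitserDokchitser2010, Thm 1.4] -/
theorem shaCorank_eq_zero_or_two_le_zywinaCurve (hpar : ∀ (V : WeierstrassCurve ℚ) [V.IsElliptic], p_parity V 2)
    (h : ZywinaAdmissible m n) [(zywinaCurve m n).IsElliptic] (p : ℕ) [Fact p.Prime]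
    (hparp : p_parity (zywinaCurve m n) p) :
    (zywinaCurve m n).shaCorank p = 0 ∨ 2 ≤ (zywinaCurve m n).shaCorank p := by
  obtain ⟨k, hk⟩ := even_shaCorank_zywinaCurve hpar h p hparp
  omega

end Parity

section Residual

variable {m n : ℕ}

/-- An even element of `ℕ∞` which is `≥ 2` and `≠ 2` is `≥ 4`. -/
theorem four_le_of_two_le_of_ne_two_of_even {k : ℕ∞} (hle : 2 ≤ k) (hne : k ≠ 2) (heven : Even k.toNat) : 4 ≤ k := by
  induction k using ENat.recTopCoe with
  | top => exact le_top
  | coe k =>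
    simp only [ENat.toNat_coe] at heven
    have h2 : 2 ≤ k := by exact_mod_cast hle
    have h2' : k ≠ 2 := fun e ↦ hne (by simp [e])
    obtain ⟨j, hj⟩ := heven
    have : 4 ≤ k := by omega
    exact_mod_cast this

/-- **THE RESIDUAL ALTERNATIVE (door + parity).** On a member of `zywinaClass 5 K m₁ M` (`0 < K`, `5 ∤ m₁`, `5^K ∤ m₁⁴ − 1`,
`7 ∣ M`), newform `f` at the conductor level, granting PRS 85, BCS and `2`-parity:
EITHER `ord_{T=0} L_5(E_{m,n},T) = 2 ∧ Ш(E_{m,n})[5^∞]` finite, OR `4 ≤ ord_{T=0} L_5(E_{m,n},T) ∧ Ш(E_{m,n})[5^∞]` infinite.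
CONDITIONAL on `h85`, `hMC`, `hpar`. [cite: BalakrishnanMullerStein2015, Thm. 1.7] [cite: BurungaleCastellaSkinner2025, Thm. 1.1.2 (a)]
[cite: DokchitserDokchitser2010, Thm 1.4] [cite: GreenbergLNM1716, §5 (p. 181, `λ_E^{anal} = 1` passage)] -/
theorem door_or_residual_of_mem_zywinaClass [Fact (Nat.Prime 5)]
    (h85 : Schneider1985_order_charGenerator) (hMC : burungale_castella_skinner_charIdeal_eq_padicLFunction)
    (hpar : ∀ (V : WeierstrassCurve ℚ) [V.IsElliptic], p_parity V 2)
    {K m₁ M : ℕ} (hK : 0 < K) (h5m₁ : ¬ 5 ∣ m₁) (hμ : ¬ (5 : ℤ) ^ K ∣ (m₁ : ℤ) ^ (5 - 1) - 1) (h7M : 7 ∣ M)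
    (hmn : (m, n) ∈ zywinaClass 5 K m₁ M) [(zywinaCurve m n).IsElliptic] [(zywinaCurve m n).IsGloballyMinimal]
    [NeZero ((zywinaCurve m n).conductorNorm ℤ)] {f : CuspForm (Gamma0 ((zywinaCurve m n).conductorNorm ℤ)) 2}
    (hf : IsNewformOf (zywinaCurve m n) f) :
    ((padicLFunction f (unitRoot (zywinaCurve m n) 5 : ℚ_[5])).order = 2 ∧
        Finite (AddCommGroup.primaryComponent (zywinaCurve m n).sha 5)) ∨
      (4 ≤ (padicLFunction f (unitRoot (zywinaCurve m n) 5 : ℚ_[5])).order ∧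
        ¬ Finite (AddCommGroup.primaryComponent (zywinaCurve m n).sha 5)) := by
  obtain ⟨hle, hdoor, -⟩ := keys_five_of_mem_zywinaClass h85 hMC hK h5m₁ hμ h7M hmn hf
  obtain ⟨hgood, hord⟩ := goodOrdinary_five_zywinaCurve hmn.1
  have hord' : IsOrdinaryAt (zywinaCurve m n) 5 := ⟨hgood, by exact_mod_cast hord⟩
  have heven := even_toNat_order_padicLFunction_zywinaCurve hpar hmn.1 5 hord' hf
  by_cases hfin : Finite (AddCommGroup.primaryComponent (zywinaCurve m n).sha 5)
  · exact Or.inl ⟨hdoor.mpr hfin, hfin⟩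
  · exact Or.inr ⟨four_le_of_two_le_of_ne_two_of_even hle (fun h2 ↦ hfin (hdoor.mp h2)) heven, hfin⟩

/-- **THE RESIDUAL ALTERNATIVE in corank currency** (adding `5`-parity): EITHER `ord_{T=0} L_5(E_{m,n},T) = 2 ∧ t_5(E_{m,n}) = 0`
OR `4 ≤ ord_{T=0} L_5(E_{m,n},T) ∧ 2 ≤ t_5(E_{m,n})`. CONDITIONAL on `h85`, `hMC`, `hpar`, `hpar5`.
[cite: BalakrishnanMullerStein2015, Thm. 1.7] [cite: BurungaleCastellaSkinner2025, Thm. 1.1.2 (a)]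
[cite: DokchitserDokchitser2010, Thm 1.4] [cite: GreenbergLNM1716, §5 (p. 181, `λ_E^{anal} = 1` passage)] -/
theorem door_or_residual_shaCorank_of_mem_zywinaClass [Fact (Nat.Prime 5)]
    (h85 : Schneider1985_order_charGenerator) (hMC : burungale_castella_skinner_charIdeal_eq_padicLFunction)
    (hpar : ∀ (V : WeierstrassCurve ℚ) [V.IsElliptic], p_parity V 2) (hpar5 : p_parity (zywinaCurve m n) 5)
    {K m₁ M : ℕ} (hK : 0 < K) (h5m₁ : ¬ 5 ∣ m₁) (hμ : ¬ (5 : ℤ) ^ K ∣ (m₁ : ℤ) ^ (5 - 1) - 1) (h7M : 7 ∣ M)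
    (hmn : (m, n) ∈ zywinaClass 5 K m₁ M) [(zywinaCurve m n).IsElliptic] [(zywinaCurve m n).IsGloballyMinimal]
    [NeZero ((zywinaCurve m n).conductorNorm ℤ)] {f : CuspForm (Gamma0 ((zywinaCurve m n).conductorNorm ℤ)) 2}
    (hf : IsNewformOf (zywinaCurve m n) f) :
    ((padicLFunction f (unitRoot (zywinaCurve m n) 5 : ℚ_[5])).order = 2 ∧ (zywinaCurve m n).shaCorank 5 = 0) ∨
      (4 ≤ (padicLFunction f (unitRoot (zywinaCurve m n) 5 : ℚ_[5])).order ∧ 2 ≤ (zywinaCurve m n).shaCorank 5) := by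
  rcases door_or_residual_of_mem_zywinaClass h85 hMC hpar hK h5m₁ hμ h7M hmn hf with ⟨h2, hfin⟩ | ⟨h4, hinf⟩
  · exact Or.inl ⟨h2, (finite_primaryComponent_sha_iff_shaCorank_eq_zero (zywinaCurve m n) 5).mp hfin⟩
  · refine Or.inr ⟨h4, ?_⟩
    rcases shaCorank_eq_zero_or_two_le_zywinaCurve hpar hmn.1 5 hpar5 with h0 | h2
    · exact absurd ((finite_primaryComponent_sha_iff_shaCorank_eq_zero (zywinaCurve m n) 5).mpr h0) hinf
    · exact h2

end Residual

/-! ## On infinitely many isomorphism classes (mod Tao–Ziegler) -/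

section Infinite

/-- **Door-or-residual on infinitely many `j`** (mod `hTZ`, `h85`, `hMC`, `hpar`): infinitely many `j(E)`, `E/ℚ` of rank `2`,
such that for every newform `f` of `E` at the conductor level EITHER `ord_{T=0} L_5(E,T) = 2 ∧ Ш(E)[5^∞]` finite OR
`4 ≤ ord_{T=0} L_5(E,T) ∧ Ш(E)[5^∞]` infinite. CONDITIONAL on `hTZ`, `h85`, `hMC`, `hpar`.
[cite: Zywina2025, Thm 1.1 and Thm 1.2] [cite: TaoZiegler2008, Thm. 1.3] [cite: BalakrishnanMullerStein2015, Thm. 1.7]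
[cite: BurungaleCastellaSkinner2025, Thm. 1.1.2 (a)] [cite: DokchitserDokchitser2010, Thm 1.4] -/
theorem infinite_setOf_j_door_or_residual [Fact (Nat.Prime 5)] (hTZ : TaoZiegler2008_polynomialProgressions)
    (h85 : Schneider1985_order_charGenerator) (hMC : burungale_castella_skinner_charIdeal_eq_padicLFunction)
    (hpar : ∀ (V : WeierstrassCurve ℚ) [V.IsElliptic], p_parity V 2) :
    {j : ℚ | ∃ (W : WeierstrassCurve ℚ) (hW : W.IsElliptic) (_ : W.IsGloballyMinimal) (_ : NeZero (W.conductorNorm ℤ)),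
      @WeierstrassCurve.j _ _ W hW = j ∧ W.mordellWeilRank = 2 ∧
      ∀ (f : CuspForm (Gamma0 (W.conductorNorm ℤ)) 2), IsNewformOf W f →
        ((padicLFunction f (unitRoot W 5 : ℚ_[5])).order = 2 ∧ Finite (AddCommGroup.primaryComponent W.sha 5)) ∨
        (4 ≤ (padicLFunction f (unitRoot W 5 : ℚ_[5])).order ∧
          ¬ Finite (AddCommGroup.primaryComponent W.sha 5))}.Infinite := by
  have hsub : zywinaClass 5 2 11 7 ⊆ {mn : ℕ × ℕ | ZywinaAdmissible mn.1 mn.2 ∧ 7 ∣ mn.2} := by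
    rintro ⟨a, b⟩ hq
    exact ⟨hq.1, seven_dvd_of_mem_zywinaClass (dvd_refl 7) hq⟩
  refine Set.infinite_of_injOn_mapsTo
    (ShaPrimaryTransferZywinaEqualityDoorInfinite.injOn_j_admissible_seven.mono hsub) ?_
    (zywinaClass_five_two_eleven_seven_infinite hTZ)
  rintro ⟨m, n⟩ hq
  have hq' : ZywinaAdmissible m n := hq.1
  haveI := isElliptic_zywinaCurve hq'
  haveI := isGloballyMinimal_zywinaCurve hq'
  haveI : NeZero ((zywinaCurve m n).conductorNorm ℤ) := ⟨((zywinaCurve m n).conductorNorm_pos_holds).ne'⟩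
  exact ⟨zywinaCurve m n, isElliptic_zywinaCurve hq', isGloballyMinimal_zywinaCurve hq', inferInstance,
    by simp only [dif_pos hq'], mordellWeilRank_zywinaCurve hq',
    fun f hf ↦ door_or_residual_of_mem_zywinaClass h85 hMC hpar (K := 2) (m₁ := 11) (M := 7)
      (by norm_num) (by norm_num) (by decide) (dvd_refl 7) hq hf⟩

end Infinite

end Summit.BirchSwinnertonDyer.BirchSwinnertonDyer.Theorems.ShaPrimaryTransferZywinaEqualityDoorParity
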